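import Summits.CriticalPhenomena.PercolationContinuityZ3.Theorems.PercNearOneGluingNoHeavyLowerTailSahiTwoLevelC3
import Summits.CriticalPhenomena.PercolationContinuityZ3.Theorems.SahiMasterFamilyFibreCubic

/-!
# A forced coordinate is a good axis: `E_3(U) ≥ q_a·E_3(U^{a←1})` when every configuration of `U_0` contains `a`

Support file of the one-cut programme (crux `NoHeavyLowerTail`, stmt-CriticalPhenomena-4575; cell `prim-bnk`, seat bnk-2 gen 11,
memo `run/shared/lean/prim/prim-l12/FROM-prim-bnk-2-g11-GOOD-AXIS.md` §7; companion of `…SahiGoodAxis` (conjecture GA: SOME axis of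
every triple of increasing events has nonnegative sectional defect `Φ_a(q_a) − [q_aΦ_a(1) + (1−q_a)Φ_a(0)]`, which implies Kahn's
Conjecture 5)).  Here is the one structural class where the good axis is explicit:

* `chordDefect_eq_of_forced` — if `U_0 ⊆ {ω | a ∈ ω}` (the coordinate `a` is FORCED for `U_0`, e.g. `U_0` a principal up-set `↑S`
  with `a ∈ S`), then with `A¹ = U_0^{a←1}`, `G_i = U_i^{a←1} ⊇ H_i = U_i^{a←0}` (`i = 1,2`), `δ_i = μ(G_i) − μ(H_i)`:
  **`Φ_a(q_a) − [q_aΦ_a(1) + (1−q_a)Φ_a(0)] = q_a(1−q_a)·[δ₁·Cov(A¹,G₂) + δ₂·Cov(A¹,G₁) + μ(A¹)·((1−q_a)δ₁δ₂ + μ(G₁G₂) − μ(H₁H₂))]`**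
  (ring identity in the section moments; `Φ_a(0) = E_3(∅,H₁,H₂) = 0`);
* `chord_le_cubicE3_of_forced` — hence the defect is `≥ 0` (Harris twice, monotonicity): **a forced coordinate is a good axis**, i.e.
  `E_3(μ_q; U) ≥ q_a·E_3(μ_q; U^{a←1})`.  Iterating over the forced set `S = ⋂ U_0` gives `E_3(U) ≥ μ(x_S ≡ 1)·E_3(U^{S←1})`, and for
  `U_0 = ↑S` principal (whose `1`-sections stay principal) the GA-induction of `…SahiGoodAxis` closes: a three-line route to the tree's
  theorem '`E_3 ≥ 0` when one event is a principal up-set'.  The mirror condition '`a` alone suffices for `U_0`' (`U_0^{a←1}` = everything)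
  does NOT make `a` good (memo §0: `U = (x₁ ∨ P, x₁ ∨ P, P)` has `N_{x₁} < 0`).
Everything here is proved; axioms standard. [this work]
-/

noncomputable section

open scoped Classical

namespace Summit.CriticalPhenomena.PercolationContinuityZ3.Theorems

open Finset Function MeasureTheory
open Literature.Combinatorics.Sahi2008
open Literature.Probability.LatticeModels (prodBernoulli prodBernoulli_harris)
open Literature.Probability.Percolation.DecisionTree (ind ind_of_mem ind_of_not_mem ind_nonneg)
open SahiLogDerivEnd SahiTwoLevel

namespace SahiGoodAxisForced

variable {κ : Type} [Fintype κ]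

omit [Fintype κ] in
/-- If every configuration of `A` contains `a`, the `0`-section of `A` along `a` is empty. [folklore] -/
theorem secAt_false_eq_empty_of_forced (a : κ) {A : Set (Set κ)} (hA : A ⊆ {ω | a ∈ ω}) : secAt a false A = ∅ := by
  ext ω
  simp only [Set.mem_empty_iff_false, iff_false]
  intro hω
  rw [mem_secAt] at hω
  have h := hA hω
  simp [forceAt] at h

/-- Section moments of indicators are probabilities of sections (restated with `(prodBernoulli q).real`). [this work] -/
theorem secEx_ind_eq_real (q : κ → unitInterval) (a : κ) (A : Set (Set κ)) (b : Bool) :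
    secEx q a (ind A) b = (prodBernoulli q).real (secAt a b A) := by
  rw [secEx_ind_eq_ex_secAt, ex_bernoulliWeight_ind]

/-- **THE FORCED-COORDINATE IDENTITY.**  If `U_0 ⊆ {ω | a ∈ ω}` then, with `A¹ = U_0^{a←1}`, `G_i = U_i^{a←1}`, `H_i = U_i^{a←0}`,
`Φ_a(q_a) − [q_aΦ_a(1) + (1−q_a)Φ_a(0)] = q_a(1−q_a)·[δ₁Cov(A¹,G₂) + δ₂Cov(A¹,G₁) + μ(A¹)((1−q_a)δ₁δ₂ + μ(G₁∩G₂) − μ(H₁∩H₂))]`.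
[this work] -/
theorem chordDefect_eq_of_forced (q : κ → unitInterval) (a : κ) (U : Fin 3 → Set (Set κ)) (h0 : U 0 ⊆ {ω | a ∈ ω}) :
    cubicE3 q a (ind (U 0)) (ind (U 1)) (ind (U 2)) (q a)
      - ((q a : ℝ) * cubicE3 q a (ind (U 0)) (ind (U 1)) (ind (U 2)) 1
          + (1 - (q a : ℝ)) * cubicE3 q a (ind (U 0)) (ind (U 1)) (ind (U 2)) 0) =
      (q a : ℝ) * (1 - (q a : ℝ)) *
        (((prodBernoulli q).real (secAt a true (U 1)) - (prodBernoulli q).real (secAt a false (U 1)))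
            * ((prodBernoulli q).real (secAt a true (U 0) ∩ secAt a true (U 2))
                - (prodBernoulli q).real (secAt a true (U 0)) * (prodBernoulli q).real (secAt a true (U 2)))
          + ((prodBernoulli q).real (secAt a true (U 2)) - (prodBernoulli q).real (secAt a false (U 2)))
            * ((prodBernoulli q).real (secAt a true (U 0) ∩ secAt a true (U 1))
                - (prodBernoulli q).real (secAt a true (U 0)) * (prodBernoulli q).real (secAt a true (U 1)))
          + (prodBernoulli q).real (secAt a true (U 0))
            * ((1 - (q a : ℝ)) * ((prodBernoulli q).real (secAt a true (U 1)) - (prodBernoulli q).real (secAt a false (U 1)))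
                * ((prodBernoulli q).real (secAt a true (U 2)) - (prodBernoulli q).real (secAt a false (U 2)))
              + ((prodBernoulli q).real (secAt a true (U 1) ∩ secAt a true (U 2))
                - (prodBernoulli q).real (secAt a false (U 1) ∩ secAt a false (U 2))))) := by
  have hempty : secAt a false (U 0) = ∅ := secAt_false_eq_empty_of_forced a h0
  simp only [cubicE3, ind_mul_ind, secEx_ind_eq_real, secAt_inter, hempty, Set.empty_inter, measureReal_empty]
  ring

/-- **A FORCED COORDINATE IS A GOOD AXIS**: if `U_0 ⊆ {ω | a ∈ ω}` and `U_1, U_2` are increasing, then along `a` the fibre cubic lies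
above its chord at `q_a`: `q_a·Φ_a(1) + (1−q_a)·Φ_a(0) ≤ Φ_a(q_a)`, i.e. `E_3(μ_q; U) ≥ q_a·E_3(μ_q; U^{a←1}) + (1−q_a)·E_3(μ_q; U^{a←0})`
(the last term is `0`).  In particular conjecture GA (`…SahiGoodAxis`) holds for every triple in which some event has a forced
coordinate, with that coordinate as the good axis. [this work] -/
theorem chord_le_cubicE3_of_forced (q : κ → unitInterval) (a : κ) (U : Fin 3 → Set (Set κ)) (h0 : U 0 ⊆ {ω | a ∈ ω})
    (h1 : IsUpperSet (U 1)) (h2 : IsUpperSet (U 2)) (hU0 : IsUpperSet (U 0)) :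
    (q a : ℝ) * cubicE3 q a (ind (U 0)) (ind (U 1)) (ind (U 2)) 1
        + (1 - (q a : ℝ)) * cubicE3 q a (ind (U 0)) (ind (U 1)) (ind (U 2)) 0 ≤
      cubicE3 q a (ind (U 0)) (ind (U 1)) (ind (U 2)) (q a) := by
  rw [← sub_nonneg, chordDefect_eq_of_forced q a U h0]
  have hq0 : 0 ≤ (q a : ℝ) := (q a).2.1
  have hq1 : 0 ≤ 1 - (q a : ℝ) := sub_nonneg.2 (q a).2.2
  have hA := isUpperSet_secAt a true hU0
  have hδ1 : 0 ≤ (prodBernoulli q).real (secAt a true (U 1)) - (prodBernoulli q).real (secAt a false (U 1)) :=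
    sub_nonneg.2 (measureReal_mono (secAt_false_subset_true h1 a))
  have hδ2 : 0 ≤ (prodBernoulli q).real (secAt a true (U 2)) - (prodBernoulli q).real (secAt a false (U 2)) :=
    sub_nonneg.2 (measureReal_mono (secAt_false_subset_true h2 a))
  have hc2 : 0 ≤ (prodBernoulli q).real (secAt a true (U 0) ∩ secAt a true (U 2))
      - (prodBernoulli q).real (secAt a true (U 0)) * (prodBernoulli q).real (secAt a true (U 2)) :=
    sub_nonneg.2 (prodBernoulli_harris q hA (isUpperSet_secAt a true h2) MeasurableSet.of_discrete MeasurableSet.of_discrete)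
  have hc1 : 0 ≤ (prodBernoulli q).real (secAt a true (U 0) ∩ secAt a true (U 1))
      - (prodBernoulli q).real (secAt a true (U 0)) * (prodBernoulli q).real (secAt a true (U 1)) :=
    sub_nonneg.2 (prodBernoulli_harris q hA (isUpperSet_secAt a true h1) MeasurableSet.of_discrete MeasurableSet.of_discrete)
  have hd : 0 ≤ (prodBernoulli q).real (secAt a true (U 1) ∩ secAt a true (U 2))
      - (prodBernoulli q).real (secAt a false (U 1) ∩ secAt a false (U 2)) :=
    sub_nonneg.2 (measureReal_mono (Set.inter_subset_inter (secAt_false_subset_true h1 a) (secAt_false_subset_true h2 a)))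
  have hm : 0 ≤ (prodBernoulli q).real (secAt a true (U 0)) := measureReal_nonneg
  have hin : 0 ≤ (1 - (q a : ℝ)) * ((prodBernoulli q).real (secAt a true (U 1)) - (prodBernoulli q).real (secAt a false (U 1)))
        * ((prodBernoulli q).real (secAt a true (U 2)) - (prodBernoulli q).real (secAt a false (U 2)))
      + ((prodBernoulli q).real (secAt a true (U 1) ∩ secAt a true (U 2))
        - (prodBernoulli q).real (secAt a false (U 1) ∩ secAt a false (U 2))) :=
    add_nonneg (mul_nonneg (mul_nonneg hq1 hδ1) hδ2) hd
  exact mul_nonneg (mul_nonneg hq0 hq1)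
    (add_nonneg (add_nonneg (mul_nonneg hδ1 hc2) (mul_nonneg hδ2 hc1)) (mul_nonneg hm hin))

/-- **`E_3(U) ≥ q_a·E_3(U^{a←1})` along a forced coordinate** (the same, in terms of `sahiE`): the measure-level form of
'conditioning on a forced coordinate only loses the factor `q_a`'. [this work] -/
theorem mul_sahiE_secAt_le_of_forced (q : κ → unitInterval) (a : κ) (U : Fin 3 → Set (Set κ)) (h0 : U 0 ⊆ {ω | a ∈ ω})
    (hU : ∀ i, IsUpperSet (U i)) :
    (q a : ℝ) * sahiE (bernoulliWeight q) 3 (fun j => ind (secAt a true (U j))) ≤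
      sahiE (bernoulliWeight q) 3 (fun j => ind (U j)) := by
  have h := chord_le_cubicE3_of_forced q a U h0 (hU 1) (hU 2) (hU 0)
  have hempty : secAt a false (U 0) = ∅ := secAt_false_eq_empty_of_forced a h0
  have hz : cubicE3 q a (ind (U 0)) (ind (U 1)) (ind (U 2)) 0 = 0 := by
    simp only [cubicE3, ind_mul_ind, secEx_ind_eq_real, secAt_inter, hempty, Set.empty_inter, measureReal_empty]
    ring
  rw [hz, mul_zero, add_zero, FibreCubic.cubicE3_one_eq_secAt, ← sahiE_three_ind_update_eq, update_eq_self] at h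
  exact h

end SahiGoodAxisForced

end Summit.CriticalPhenomena.PercolationContinuityZ3.Theorems
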